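import Summits.Ventures.Crystal3D.Theorems.StickyWulffConstantCoaxialWallLawVicinalCoherence
import Summits.Ventures.Crystal3D.Theorems.StickyWulffConstantCoaxialWallLawEndUniqueMulti
import HarnessLib

/-!
# Vicinal level-⅓ twins are COHERENT Σ3 twins (crux `CoaxialWallLaw`, stmt-Ventures-19481, line `WallLedgerF`)

HONEST FRAMING. Venture `Summits/Ventures/Crystal3D` (cell `crystal3d-full`), helper `--supports` the crux `CoaxialWallLaw`
of `route-Ventures-StickyWulffConstant` (REGISTERED line `WallLedgerF`, open stub `stub_coaxialTwoSlabAdhesion`).  Pure lattice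
geometry about the vicinal core (`…VicinalCore`, `…VicinalSplit`); rung credit; F-C1 not moved; NOT the crux; no census.

**`coherentTwinPair_of_vicinal_level_third`** — a pair in the VICINAL CORE (`VicinalPair`: triadic, twins vicinal
`(√3/2) sin θ < 9/20`, level-⅓ offsets registered for every wide slot dominating an admissible axis) which is a twin about a
unit menu normal `ν` and whose offset is of level ⅓ (`3·A₁⁻¹(t₂ − t₁) ∈ Λ₀`) is a COHERENT twin: `t₂ − t₁ ∈ A₁·(Λ₀ + ℤ√(2/3)ν)`
(`CoherentTwinPair`).  Proof: in the vicinal regime `⟪ν, e₃⟫² > 0.73`, so the three rising slots of `±ν` have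
`e₃`-components in `[0, √(3/2)⟪ν,e₃⟫]`; by `two_good_rising_slots` two of them are wide and dominate `ν`; the core's hypothesis
(iii) registers the offset for both; `coherentOffset_of_two_registrations` concludes.
CONSEQUENCE (`incoherent_twin_not_level_third`): the «displaced» level-⅓ twin classes `±b_{n₂(u)} + DSC` are NOT in the
vicinal core — they are FREE for arbitrary fillings at EVERY wall orientation (wide regime: in-plane walkers; vicinal regime:
two rising-slot registries), so the Σ3 census needs rows for the coherent twin only.
WHAT THIS IS NOT: not the stub; F-C1 not moved.
-/

noncomputable section

namespace Summit.Ventures.Crystal3D.Theorems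

open Summit.Ventures.Crystal3D Finset
open Literature.MathematicalPhysics.StatisticalMechanics (fccStacking barlowStacking IsHaggSeq contactDeficiency)
open scoped InnerProductSpace

/-- The twin lattice does not see the sign of the mirror normal. -/
theorem image_twinFrame_neg (G : EuclideanSpace ℝ (Fin 3) ≃ₗᵢ[ℝ] EuclideanSpace ℝ (Fin 3)) {n : EuclideanSpace ℝ (Fin 3)}
    (hn : ‖n‖ = 1) (S : Set (EuclideanSpace ℝ (Fin 3))) :
    twinFrame G (-n) '' S = twinFrame G n '' S := by
  have hn' : ‖-n‖ = 1 := by rw [norm_neg, hn]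
  rw [image_twinFrame_eq G hn' S, image_twinFrame_eq G hn S]
  refine Set.image_congr fun x _ => ?_
  rw [inner_neg_right, smul_neg, mul_neg, neg_smul, neg_neg]

/-- **Slot-height bounds for a near axis.**  If `w` is a rising slot of the unit normal `ν` (`‖w‖ = 1`,
`⟪w, ν⟫ = √(2/3)`) and `c = ⟪ν, e⟫ ≥ 0` with `c² ≥ 2/3` (`e` unit), then `0 ≤ ⟪w, e⟫` and `2⟪w, e⟫² ≤ 3c²`. -/
theorem rising_slot_height_bounds {w ν e : EuclideanSpace ℝ (Fin 3)} (hw : ‖w‖ = 1) (hν : ‖ν‖ = 1) (he : ‖e‖ = 1)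
    (hwν : ⟪w, ν⟫_ℝ = Real.sqrt (2 / 3)) (hc : 0 ≤ ⟪ν, e⟫_ℝ) (hc2 : 2 / 3 ≤ ⟪ν, e⟫_ℝ ^ 2) :
    0 ≤ ⟪w, e⟫_ℝ ∧ 2 * ⟪w, e⟫_ℝ ^ 2 ≤ 3 * ⟪ν, e⟫_ℝ ^ 2 := by
  set S : ℝ := Real.sqrt (2 / 3) with hS
  have hS2 : S ^ 2 = 2 / 3 := by rw [hS]; exact Real.sq_sqrt (by norm_num)
  have hS0 : 0 ≤ S := Real.sqrt_nonneg _
  set c : ℝ := ⟪ν, e⟫_ℝ with hcdef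
  set p : EuclideanSpace ℝ (Fin 3) := w - S • ν with hp
  set q : EuclideanSpace ℝ (Fin 3) := e - c • ν with hq
  have hνν : ⟪ν, ν⟫_ℝ = 1 := by rw [real_inner_self_eq_norm_sq, hν, one_pow]
  have hpν : ⟪p, ν⟫_ℝ = 0 := by rw [hp, inner_sub_left, real_inner_smul_left, hwν, hνν]; ring
  have hνw : ⟪ν, w⟫_ℝ = S := by rw [real_inner_comm, hwν]
  have hpp : ‖p‖ ^ 2 = 1 / 3 := by
    rw [← real_inner_self_eq_norm_sq, hp, inner_sub_left, inner_sub_right, inner_sub_right, real_inner_smul_left,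
      real_inner_smul_right, real_inner_smul_left, real_inner_smul_right, real_inner_self_eq_norm_sq, hw, hνν]
    simp only [hνw, hwν]
    nlinarith [hS2]
  have hqq : ‖q‖ ^ 2 = 1 - c ^ 2 := by
    rw [← real_inner_self_eq_norm_sq, hq, inner_sub_left, inner_sub_right, inner_sub_right, real_inner_smul_left,
      real_inner_smul_right, real_inner_smul_left, real_inner_smul_right, real_inner_self_eq_norm_sq, he, hνν,
      real_inner_comm ν e, ← hcdef]
    ring
  -- `⟪w, e⟫ = S c + x` with `x = ⟪p, q⟫`, `x² ≤ (1 − c²)/3`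
  set x : ℝ := ⟪p, q⟫_ℝ with hx
  have hwe : ⟪w, e⟫_ℝ = S * c + x := by
    have e1 : w = p + S • ν := by rw [hp]; abel
    have e2 : e = q + c • ν := by rw [hq]; abel
    rw [hx, e1, e2, inner_add_left, inner_add_right, inner_add_right, real_inner_smul_left, real_inner_smul_right,
      real_inner_smul_left, real_inner_smul_right, hpν, hνν]
    have hqν : ⟪q, ν⟫_ℝ = 0 := by rw [hq, inner_sub_left, real_inner_smul_left, hνν, real_inner_comm ν e, ← hcdef]; ring
    have hνq : ⟪ν, q⟫_ℝ = 0 := by rw [real_inner_comm, hqν]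
    simp only [hνq]
    ring
  have hx2 : x ^ 2 ≤ (1 - c ^ 2) / 3 := by
    have h1 := abs_real_inner_le_norm p q
    have h2 : x ^ 2 ≤ (‖p‖ * ‖q‖) ^ 2 := by
      rw [hx, ← sq_abs]; exact pow_le_pow_left₀ (abs_nonneg _) h1 2
    rw [mul_pow, hpp, hqq] at h2
    linarith
  rw [hwe]
  constructor
  · -- `|x| ≤ S c`
    have : x ^ 2 ≤ (S * c) ^ 2 := by rw [mul_pow, hS2]; nlinarith [hx2, hc2]
    have habs : |x| ≤ S * c := by
      rw [← Real.sqrt_sq (mul_nonneg hS0 hc), ← Real.sqrt_sq_eq_abs]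
      exact Real.sqrt_le_sqrt this
    linarith [neg_abs_le x]
  · nlinarith [sq_nonneg (S * c - 2 * x), hx2, hS2, hc2, sq_nonneg c]

/-- **Vicinal level-⅓ twins are coherent.**  See the module docstring. -/
theorem coherentTwinPair_of_vicinal_level_third
    (A₁ : EuclideanSpace ℝ (Fin 3) ≃ₗᵢ[ℝ] EuclideanSpace ℝ (Fin 3)) (t₁ : EuclideanSpace ℝ (Fin 3))
    (A₂ : EuclideanSpace ℝ (Fin 3) ≃ₗᵢ[ℝ] EuclideanSpace ℝ (Fin 3)) (t₂ : EuclideanSpace ℝ (Fin 3))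
    (hV : VicinalPair A₁ t₁ A₂ t₂)
    {ν : EuclideanSpace ℝ (Fin 3)} (hν : ‖ν‖ = 1)
    (hmenu : ∀ w ∈ fccSlots, ⟪A₁ w, ν⟫_ℝ = 0 ∨ ⟪A₁ w, ν⟫_ℝ = Real.sqrt (2 / 3) ∨ ⟪A₁ w, ν⟫_ℝ = -Real.sqrt (2 / 3))
    (htwin : A₂ '' fccStacking 1 (Real.sqrt (2 / 3)) = twinFrame A₁ ν '' fccStacking 1 (Real.sqrt (2 / 3)))
    (h3 : A₁.symm ((3 : ℝ) • (t₂ - t₁)) ∈ fccStacking 1 (Real.sqrt (2 / 3))) :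
    CoherentTwinPair A₁ t₁ A₂ t₂ := by
  set e : EuclideanSpace ℝ (Fin 3) := EuclideanSpace.single (2 : Fin 3) (1 : ℝ) with he
  have hen : ‖e‖ = 1 := by rw [he, PiLp.norm_single, norm_one]
  obtain ⟨_, hvic, hreg⟩ := hV
  -- sign normalisation: `ν'` with `⟪ν', e⟫ ≥ 0`
  obtain ⟨ν', hν', hmenu', htwin', hc0, hνν'⟩ : ∃ ν' : EuclideanSpace ℝ (Fin 3), ‖ν'‖ = 1 ∧
      (∀ w ∈ fccSlots, ⟪A₁ w, ν'⟫_ℝ = 0 ∨ ⟪A₁ w, ν'⟫_ℝ = Real.sqrt (2 / 3) ∨ ⟪A₁ w, ν'⟫_ℝ = -Real.sqrt (2 / 3)) ∧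
      A₂ '' fccStacking 1 (Real.sqrt (2 / 3)) = twinFrame A₁ ν' '' fccStacking 1 (Real.sqrt (2 / 3)) ∧
      0 ≤ ⟪ν', e⟫_ℝ ∧ ⟪ν', e⟫_ℝ ^ 2 = ⟪ν, e⟫_ℝ ^ 2 := by
    by_cases h : 0 ≤ ⟪ν, e⟫_ℝ
    · exact ⟨ν, hν, hmenu, htwin, h, rfl⟩
    · refine ⟨-ν, by rw [norm_neg, hν], menu_neg A₁ hmenu, by rw [image_twinFrame_neg A₁ hν]; exact htwin, ?_, ?_⟩
      · rw [inner_neg_left]; linarith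
      · rw [inner_neg_left, neg_sq]
  have hvic' := hvic ν' hν' hmenu' htwin'
  set c : ℝ := ⟪ν', e⟫_ℝ with hcdef
  -- `c² > 0.73 ≥ 2/3`
  have hc1 : c ^ 2 ≤ 1 := by
    have h1 := abs_real_inner_le_norm ν' e
    rw [hν', hen, one_mul] at h1
    have : |c| ^ 2 ≤ 1 ^ 2 := pow_le_pow_left₀ (abs_nonneg _) h1 2
    rw [sq_abs, one_pow] at this; exact this
  have hc2 : 2 / 3 ≤ c ^ 2 := by
    have hs0 : 0 ≤ Real.sqrt (1 - c ^ 2) := Real.sqrt_nonneg _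
    have hss : Real.sqrt (1 - c ^ 2) ^ 2 = 1 - c ^ 2 := Real.sq_sqrt (by linarith)
    have h3 : Real.sqrt 3 ^ 2 = 3 := Real.sq_sqrt (by norm_num)
    have h30 : 0 ≤ Real.sqrt 3 := Real.sqrt_nonneg _
    have hlt : (Real.sqrt 3 / 2 * Real.sqrt (1 - c ^ 2)) ^ 2 < (9 / 20 : ℝ) ^ 2 :=
      pow_lt_pow_left₀ hvic' (by positivity) two_ne_zero
    nlinarith [hlt, hss, h3]
  -- the three rising slots of `ν'`
  obtain ⟨u₁, hu₁, u₂, hu₂, u₃, hu₃, hn₁, hn₂, hn₃, h12, h13, h23, -, -⟩ := exists_far_frame A₁ hν' hmenu'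
  have nw : ∀ u ∈ fccSlots, ‖A₁ u‖ = 1 := fun u hu => by rw [LinearIsometryEquiv.norm_map, norm_eq_one_of_mem_fccSlots hu]
  have ip : ∀ u u' : EuclideanSpace ℝ (Fin 3), ⟪A₁ u, A₁ u'⟫_ℝ = ⟪u, u'⟫_ℝ := fun u u' => A₁.inner_map_map u u'
  obtain ⟨hl₁, hh₁⟩ := rising_slot_height_bounds (nw u₁ hu₁) hν' hen hn₁ hc0 hc2
  obtain ⟨hl₂, hh₂⟩ := rising_slot_height_bounds (nw u₂ hu₂) hν' hen hn₂ hc0 hc2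
  obtain ⟨hl₃, hh₃⟩ := rising_slot_height_bounds (nw u₃ hu₃) hν' hen hn₃ hc0 hc2
  obtain ⟨wᵢ, wⱼ, hcases, ⟨hiw, hid⟩, ⟨hjw, hjd⟩⟩ := two_good_rising_slots (nw u₁ hu₁) (nw u₂ hu₂) (nw u₃ hu₃) hν' hen
    (by rw [ip]; exact h12) (by rw [ip]; exact h13) (by rw [ip]; exact h23) hn₁ hn₂ hn₃ hc0 ⟨hl₁, hl₂, hl₃⟩ ⟨hh₁, hh₂, hh₃⟩
  -- recover the slots
  obtain ⟨uᵢ, uⱼ, huᵢ, huⱼ, hij, rfl, rfl⟩ : ∃ uᵢ uⱼ : EuclideanSpace ℝ (Fin 3), uᵢ ∈ fccSlots ∧ uⱼ ∈ fccSlots ∧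
      ⟪uᵢ, uⱼ⟫_ℝ = 1 / 2 ∧ wᵢ = A₁ uᵢ ∧ wⱼ = A₁ uⱼ := by
    rcases hcases with ⟨rfl, rfl⟩ | ⟨rfl, rfl⟩ | ⟨rfl, rfl⟩
    · exact ⟨u₁, u₂, hu₁, hu₂, h12, rfl, rfl⟩
    · exact ⟨u₁, u₃, hu₁, hu₃, h13, rfl, rfl⟩
    · exact ⟨u₂, u₃, hu₂, hu₃, h23, rfl, rfl⟩
  have hiν : ⟪A₁ uᵢ, ν'⟫_ℝ = Real.sqrt (2 / 3) := by
    rcases hcases with ⟨h, -⟩ | ⟨h, -⟩ | ⟨h, -⟩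
    · rw [A₁.injective h]; exact hn₁
    · rw [A₁.injective h]; exact hn₁
    · rw [A₁.injective h]; exact hn₂
  have hjν : ⟪A₁ uⱼ, ν'⟫_ℝ = Real.sqrt (2 / 3) := by
    rcases hcases with ⟨-, h⟩ | ⟨-, h⟩ | ⟨-, h⟩
    · rw [A₁.injective h]; exact hn₂
    · rw [A₁.injective h]; exact hn₃
    · rw [A₁.injective h]; exact hn₃
  -- domination in the core's form
  have dom : ∀ u : EuclideanSpace ℝ (Fin 3), 0 ≤ ⟪A₁ u, e⟫_ℝ → 1 - c ^ 2 ≤ 2 * ⟪A₁ u, e⟫_ℝ ^ 2 →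
      Real.sqrt (1 - ⟪ν', e⟫_ℝ ^ 2) ≤ Real.sqrt 2 * ⟪A₁ u, e⟫_ℝ := by
    intro u hu0 hd
    rw [← hcdef, show Real.sqrt 2 * ⟪A₁ u, e⟫_ℝ = Real.sqrt (2 * ⟪A₁ u, e⟫_ℝ ^ 2) by
      rw [Real.sqrt_mul (by norm_num), Real.sqrt_sq hu0]]
    exact Real.sqrt_le_sqrt hd
  have hwide : ∀ u : EuclideanSpace ℝ (Fin 3), 1 / 2 ≤ ⟪A₁ u, e⟫_ℝ → (9 / 20 : ℝ) ≤ ⟪A₁ u, e⟫_ℝ := fun u h => by linarith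
  -- the two registrations from hypothesis (iii) of the vicinal core
  have hRi := hreg h3 ν' hν' hmenu' (Or.inr htwin') uᵢ huᵢ (hwide uᵢ hiw) (dom uᵢ (by linarith) hid) ν' hν' hmenu' hiν
    (Or.inr htwin')
  have hRj := hreg h3 ν' hν' hmenu' (Or.inr htwin') uⱼ huⱼ (hwide uⱼ hjw) (dom uⱼ (by linarith) hjd) ν' hν' hmenu' hjν
    (Or.inr htwin')
  obtain ⟨a, ha⟩ := coherentOffset_of_two_registrations A₁ hν' hmenu' huᵢ huⱼ hij hiν hjν hRi hRj
  exact ⟨ν', hν', hmenu', htwin', a, ha⟩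

/-- **Consequence for the split**: a twin pair of the vicinal core that is NOT a coherent twin has an offset of DEEPER level
(`3·A₁⁻¹(t₂ − t₁) ∉ Λ₀`): the incoherent debt `CoaxialTwoSlabAdhesionIncoherent` contains no level-⅓ twin. -/
theorem incoherent_twin_not_level_third
    (A₁ : EuclideanSpace ℝ (Fin 3) ≃ₗᵢ[ℝ] EuclideanSpace ℝ (Fin 3)) (t₁ : EuclideanSpace ℝ (Fin 3))
    (A₂ : EuclideanSpace ℝ (Fin 3) ≃ₗᵢ[ℝ] EuclideanSpace ℝ (Fin 3)) (t₂ : EuclideanSpace ℝ (Fin 3))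
    (hV : VicinalPair A₁ t₁ A₂ t₂) (hnot : ¬ CoherentTwinPair A₁ t₁ A₂ t₂)
    {ν : EuclideanSpace ℝ (Fin 3)} (hν : ‖ν‖ = 1)
    (hmenu : ∀ w ∈ fccSlots, ⟪A₁ w, ν⟫_ℝ = 0 ∨ ⟪A₁ w, ν⟫_ℝ = Real.sqrt (2 / 3) ∨ ⟪A₁ w, ν⟫_ℝ = -Real.sqrt (2 / 3))
    (htwin : A₂ '' fccStacking 1 (Real.sqrt (2 / 3)) = twinFrame A₁ ν '' fccStacking 1 (Real.sqrt (2 / 3))) :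
    A₁.symm ((3 : ℝ) • (t₂ - t₁)) ∉ fccStacking 1 (Real.sqrt (2 / 3)) :=
  fun h3 => hnot (coherentTwinPair_of_vicinal_level_third A₁ t₁ A₂ t₂ hV hν hmenu htwin h3)

end Summit.Ventures.Crystal3D.Theorems

end
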